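/-
Copyright (c) 2026. All rights reserved.
Released under Apache 2.0 license as described in the file LICENSE.
-/
import Literature.AlgebraicGeometry.Pohlmann1968.DegenerateCMTypesAbelianCMFieldPrimePower
import HarnessLib

/-!
# The rank gap for abelian CM fields of degree `2p^k`: a degenerate CM type has rank at most `p^k + 2 − p`
# (the Galois conjugates `χᵃ` of a vanishing odd character vanish)

T. Kubota's Lemma 2 [Kubota1965]: `rank(S) = 1 + #{χ odd : χ(S) ≠ 0}`.  If one odd character `χ` of an abelian
group of order `2p^k` vanishes on the CM type `S`, then so do its `φ(p^{j+1}) ≥ p − 1` powers `χᵃ`, `a` prime to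
`2p^{j+1}` (classically: the sum `χ(S) ∈ ℚ(ζ_{2p^{j+1}})` is killed by the Galois group; here from the FIBRE
CRITERION of `DegenerateCMTypesAbelianPrimePower`: `χᵃ` has the fibres of `χ` and `x ↦ xᵃ` permutes the values).
Hence **a degenerate CM type of an abelian CM field of degree `2p^k` has rank `≤ p^k + 2 − p`** — no rank lies
strictly between `p^k + 2 − p` and `p^k + 1` (dimension `9`: `9` is not a rank, B. Dodson [Dodson1987] Remark
4.7: "Rank(`A`) `= 6, 8`, or `10`"; dimension `27`: `27` is not a rank; dimension `125`: `123, 124, 125` are not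
ranks).  K. Ribet's bound (Dodson's Thm. 1.12, tree `CMTypeRankPrimeSquareBound`) is the complementary LOWER
bound for primitive types.  THEOREMS ONLY.

## What is proved

* §1 (group level, any finite abelian group; `|G| = 2p^k` for the counts): **`sum_char_pow_eq_zero_iff`**
  (`χᵃ(S) = 0 ⟺ χ(S) = 0` for `a` prime to `2p^{j+1}`), **`le_ncard_oddChar_vanishing`** (a vanishing odd
  character gives `≥ p − 1` of them), **`typeRank_add_le_of_ne`** (`rank ≠ p^k + 1 ⟹ rank + (p − 1) ≤ p^k + 1`).
* §2 (abelian CM fields of degree `2p^k`): **`cmTypeRank_add_le_of_not_isNondegenerate`**,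
  **`cmTypeRank_eq_or_le`** (coordinate-free: `Rank = p^k + 1` or `Rank ≤ p^k + 2 − p`),
  `cmTypeRank_eq_or_le_fiftyFour` (`28` or `≤ 26`), `cmTypeRank_eq_or_le_twoHundredFifty` (`126` or `≤ 122`).

## References

* [Kubota1965] T. Kubota, Trans. AMS 118 (1965), §4 Lemma 2.
* [Dodson1987] B. Dodson, J. Algebra 111 (1987): Thm. 1.12, Remark 4.7.
* [Hazama2003CyclicCM] F. Hazama, J. Math. Sci. Univ. Tokyo 10 (2003): Prop. 4.3.

## Provenance

Lane `lit-hodgefound` (Track 2, Layer A3/B), seat `lit-hodgefound-p10` generation 35, row g35-#19; neighbours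
cited by name, nothing restated: `DegenerateCMTypesAbelianPrimePower` (`sum_char_eq_zero_iff_fibres`,
`exists_isPrimitiveRoot_of_sum_char_eq_zero`), `DegenerateCMTypesAbelianCMFieldPrimePower` (frame),
`CMTypeRankCharacters` (Kubota), `DegenerateCMTypesCompositeDimension` (`ncard_oddChar`).
-/

open scoped BigOperators NumberField IsMulCommutative Classical
open CategoryTheory NumberField

namespace Literature.AlgebraicGeometry.Pohlmann1968

namespace AbelianPrimePower

open Literature.NumberTheory.ComplexMultiplication
open Literature.NumberTheory.ComplexMultiplication.CyclicCMType
open Literature.NumberTheory.ComplexMultiplication.CyclicCMType.AbelianPrimePow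
open Literature.AlgebraicGeometry.Motives (AbelianVariety CMType)
open Literature.AlgebraicGeometry.HodgeTheory
open Literature.AlgebraicGeometry.ComplexMultiplication (IsCMTypeRealisation isSimple_iff_isPrimitive)
open Literature.AlgebraicGeometry.Pohlmann1968.CyclicTwoOddPrimes (gal_comm isCMTypeWith_galType
  cmTypeRank_eq_typeRank_galType)
open Literature.AlgebraicGeometry.ComplexMultiplication.CyclicTwoPower (exists_conj_gal)
open Dodson1984 (ncard_oddChar)

/-! ## §1 Group level: the Galois conjugates `χᵃ` of a vanishing odd character vanish -/

section Group

variable {G : Type*} [CommGroup G] [Fintype G] [DecidableEq G] {p : ℕ} [hp : Fact p.Prime] {ρ : G} {Φ : Finset G}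

omit [Fintype G] [DecidableEq G] hp in
/-- `χ(g^e) = χ(g)^e`. [folklore] -/
private theorem char_pow (χ : AddChar (Additive G) ℂ) (g : G) (e : ℕ) :
    χ (Additive.ofMul (g ^ e)) = χ (Additive.ofMul g) ^ e := by
  rw [ofMul_pow, AddChar.map_nsmul_eq_pow]

omit [Fintype G] [DecidableEq G] hp in
/-- `χ(gh) = χ(g)χ(h)`. [folklore] -/
private theorem char_mul (χ : AddChar (Additive G) ℂ) (g h : G) :
    χ (Additive.ofMul (g * h)) = χ (Additive.ofMul g) * χ (Additive.ofMul h) := by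
  rw [ofMul_mul, AddChar.map_add_eq_mul]

/-- **Raising to a power prime to `N` is injective on the `N`-th roots of unity.** [folklore] -/
private theorem eq_of_pow_eq_pow_of_coprime {N a : ℕ} (hN : 1 < N) (ha : N.Coprime a) {x y : ℂ} (hx : x ^ N = 1)
    (hy : y ^ N = 1) (h : x ^ a = y ^ a) : x = y := by
  obtain ⟨m, -, hm⟩ := Nat.exists_mul_mod_eq_one_of_coprime ha.symm hN
  have key : ∀ z : ℂ, z ^ N = 1 → z ^ (a * m) = z := by
    intro z hz
    rw [← Nat.mod_add_div (a * m) N, pow_add, pow_mul, hz, one_pow, mul_one, hm, pow_one]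
  rw [← key x hx, ← key y hy, pow_mul, pow_mul, h]

omit [Fintype G] [DecidableEq G] hp in
/-- `ωᵃ = ωᵇ` for a primitive `n`-th root of unity `ω` forces `a ≡ b (mod n)`. [folklore] -/
private theorem modEq_of_pow_eq_pow {ω : ℂ} {n : ℕ} (hn : n ≠ 0) (hω : IsPrimitiveRoot ω n) {a b : ℕ}
    (h : ω ^ a = ω ^ b) : a ≡ b [MOD n] := by
  wlog hab : a ≤ b generalizing a b
  · exact (this h.symm (le_of_not_ge hab)).symm
  obtain ⟨c, rfl⟩ := Nat.exists_eq_add_of_le hab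
  rw [pow_add] at h
  have hne : ω ^ a ≠ 0 := pow_ne_zero _ (hω.ne_zero hn)
  have h1 : ω ^ c = 1 := (mul_eq_left₀ hne).1 h.symm
  refine (Nat.modEq_iff_dvd' hab).2 ?_
  rw [Nat.add_sub_cancel_left]
  exact (hω.pow_eq_one_iff_dvd c).1 h1

/-- **The power `χᵃ` (`a` prime to `2p^{j+1}`) vanishes on the type iff `χ` does** — via the fibre criterion:
`χᵃ` has the same fibres as `χ`, and `x ↦ xᵃ` permutes the values. (The classical argument is Galois conjugation
in `ℚ(ζ_{2p^{j+1}})`.) [cite: Kubota1965, §4 Lemma 2] [cite: Hazama2003CyclicCM, Prop. 4.3] -/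
theorem sum_char_pow_eq_zero_iff (hp2 : p ≠ 2) (h : IsCMTypeWith ρ (Φ : Set G)) (χ : AddChar (Additive G) ℂ)
    (hχ : χ (Additive.ofMul ρ) = -1) {u : G} {j : ℕ} (hu : IsPrimitiveRoot (χ (Additive.ofMul u)) (p ^ (j + 1)))
    (hall : ∀ g : G, χ (Additive.ofMul g) ^ (2 * p ^ (j + 1)) = 1) {a : ℕ} (ha : (2 * p ^ (j + 1)).Coprime a) :
    ∑ s ∈ Φ, (χ ^ a) (Additive.ofMul s) = 0 ↔ ∑ s ∈ Φ, χ (Additive.ofMul s) = 0 := by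
  have hodd : Odd a := Nat.coprime_two_left.1 ha.coprime_mul_right
  have hχa : (χ ^ a) (Additive.ofMul ρ) = -1 := by rw [AddChar.pow_apply, hχ, hodd.neg_one_pow]
  have hua : IsPrimitiveRoot ((χ ^ a) (Additive.ofMul u)) (p ^ (j + 1)) := by
    rw [AddChar.pow_apply]
    exact hu.pow_of_coprime a (ha.coprime_mul_left).symm
  have halla : ∀ g : G, (χ ^ a) (Additive.ofMul g) ^ (2 * p ^ (j + 1)) = 1 := by
    intro g
    rw [AddChar.pow_apply, ← pow_mul, mul_comm, pow_mul, hall, one_pow]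
  have hN : 1 < 2 * p ^ (j + 1) := by
    have := pow_pos hp.out.pos (j + 1)
    omega
  -- the fibres of `χᵃ` over `vᵃ` are the fibres of `χ` over `v`, for values `v = χ(g₀)`
  have hfib : ∀ g₀ : G, (Φ.filter fun s => (χ ^ a) (Additive.ofMul s) = (χ ^ a) (Additive.ofMul g₀)) =
      Φ.filter fun s => χ (Additive.ofMul s) = χ (Additive.ofMul g₀) := by
    intro g₀
    refine Finset.filter_congr fun s _ => ?_
    rw [AddChar.pow_apply, AddChar.pow_apply]
    exact ⟨fun hs => eq_of_pow_eq_pow_of_coprime hN ha (hall s) (hall g₀) hs, fun hs => by rw [hs]⟩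
  rw [sum_char_eq_zero_iff_fibres hp2 h hχa hua halla, sum_char_eq_zero_iff_fibres hp2 h hχ hu hall]
  refine forall_congr' fun g => ?_
  rw [show (χ ^ a) (Additive.ofMul g) * (χ ^ a) (Additive.ofMul u) ^ p ^ j = (χ ^ a) (Additive.ofMul (g * u ^ p ^ j))
      by rw [char_mul, char_pow],
    show χ (Additive.ofMul g) * χ (Additive.ofMul u) ^ p ^ j = χ (Additive.ofMul (g * u ^ p ^ j))
      by rw [char_mul, char_pow], hfib, hfib]

/-- **A vanishing odd character comes with `φ(p^{j+1}) ≥ p − 1` vanishing odd characters** (its powers `χᵃ`,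
`a` prime to `2p^{j+1}`, pairwise distinct) — on a group of order `2p^k`. [cite: Kubota1965, §4 Lemma 2]
[cite: Dodson1987, Thm. 1.12 (proof)] -/
theorem le_ncard_oddChar_vanishing (hp2 : p ≠ 2) {k : ℕ} (hcard : Fintype.card G = 2 * p ^ k)
    (h : IsCMTypeWith ρ (Φ : Set G)) (χ : AddChar (Additive G) ℂ) (hχ : χ (Additive.ofMul ρ) = -1)
    (h0 : ∑ s ∈ Φ, χ (Additive.ofMul s) = 0) :
    p - 1 ≤ {χ' : AddChar (Additive G) ℂ | χ' (Additive.ofMul ρ) = -1 ∧ ∑ s ∈ Φ, χ' (Additive.ofMul s) = 0}.ncard := by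
  obtain ⟨u, j, hu, hall⟩ := exists_isPrimitiveRoot_of_sum_char_eq_zero hp2 hcard h χ h0
  set n := p ^ (j + 1) with hn
  have hn1 : 1 ≤ p ^ j := Nat.one_le_pow _ _ hp.out.pos
  have hoddn : Odd n := (hp.out.odd_of_ne_two hp2).pow
  set T : Finset ℕ := (Finset.range (2 * n)).filter fun a => (2 * n).Coprime a with hT
  have hTcard : T.card = p ^ j * (p - 1) := by
    rw [hT, ← Nat.totient_eq_card_coprime, Nat.totient_mul (Nat.coprime_two_left.2 hoddn), Nat.totient_two,
      one_mul, hn, Nat.totient_prime_pow_succ hp.out]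
  -- `a ↦ χᵃ` is injective on `T` and lands in the vanishing odd characters
  have hinj : Set.InjOn (fun a : ℕ => χ ^ a) ↑T := by
    intro a ha b hb hab
    rw [Finset.coe_filter, Set.mem_setOf_eq, Finset.mem_range] at ha hb
    have hu' := congrArg (fun ψ : AddChar (Additive G) ℂ => ψ (Additive.ofMul u)) hab
    simp only [AddChar.pow_apply] at hu'
    replace hu' : a ≡ b [MOD n] := modEq_of_pow_eq_pow (pow_ne_zero _ hp.out.ne_zero) hu hu'
    have h2 : a ≡ b [MOD 2] := by
      have hao : Odd a := Nat.coprime_two_left.1 ha.2.coprime_mul_right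
      have hbo : Odd b := Nat.coprime_two_left.1 hb.2.coprime_mul_right
      rw [Nat.ModEq, Nat.odd_iff.1 hao, Nat.odd_iff.1 hbo]
    have hab' : a ≡ b [MOD 2 * n] := (Nat.modEq_and_modEq_iff_modEq_mul (Nat.coprime_two_left.2 hoddn)).1 ⟨h2, hu'⟩
    exact Nat.ModEq.eq_of_lt_of_lt hab' ha.1 hb.1
  have hsub : (↑(T.image fun a : ℕ => χ ^ a) : Set (AddChar (Additive G) ℂ)) ⊆
      {χ' : AddChar (Additive G) ℂ | χ' (Additive.ofMul ρ) = -1 ∧ ∑ s ∈ Φ, χ' (Additive.ofMul s) = 0} := by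
    intro ψ hψ
    rw [Finset.coe_image] at hψ
    obtain ⟨a, ha, rfl⟩ := hψ
    rw [Finset.coe_filter, Set.mem_setOf_eq] at ha
    have hodd : Odd a := Nat.coprime_two_left.1 ha.2.coprime_mul_right
    refine ⟨by rw [AddChar.pow_apply, hχ, hodd.neg_one_pow], ?_⟩
    exact (sum_char_pow_eq_zero_iff hp2 h χ hχ hu hall ha.2).2 h0
  have hle := Set.ncard_le_ncard hsub (Set.toFinite _)
  rw [Set.ncard_coe_finset, Finset.card_image_of_injOn hinj, hTcard] at hle
  calc p - 1 = 1 * (p - 1) := (one_mul _).symm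
    _ ≤ p ^ j * (p - 1) := Nat.mul_le_mul_right _ hn1
    _ ≤ _ := hle

/-- **THE RANK GAP on an abelian group of order `2p^k`**: a degenerate CM type has rank at most
`p^k + 2 − p` — the defect `#{χ odd : χ(S) = 0}` of a degenerate type is at least `p − 1`.  No rank strictly
between `p^k + 2 − p` and `p^k + 1` occurs (dimension `9`: no rank `9`; Dodson's Remark 4.7: "Rank(`A`) `= 6, 8`,
or `10`"). [cite: Kubota1965, §4 Lemma 2] [cite: Dodson1987, Thm. 1.12 and Remark 4.7] -/
theorem typeRank_add_le_of_ne (hp2 : p ≠ 2) {k : ℕ} (hcard : Fintype.card G = 2 * p ^ k)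
    (h : IsCMTypeWith ρ (Φ : Set G)) (hne : typeRank G (Φ : Set G) ≠ p ^ k + 1) :
    typeRank G (Φ : Set G) + (p - 1) ≤ p ^ k + 1 := by
  have hρ1 : ρ ≠ 1 := by
    intro h1; have := h.rho_smul_ne (1 : G); rw [h1, smul_eq_mul, one_mul] at this; exact this rfl
  have hρ2 : ρ * ρ = 1 := by have := h.invol (1 : G); simpa [smul_eq_mul] using this
  have hkub := h.typeRank_add_ncard_oddCharacters_vanishing
  rw [ncard_oddChar hρ1 hρ2 hcard] at hkub
  have hV : {χ : AddChar (Additive G) ℂ | χ (Additive.ofMul ρ) = -1 ∧ ∑ s ∈ Φ, χ (Additive.ofMul s) = 0}.ncard ≠ 0 := by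
    omega
  obtain ⟨χ, hχ, h0⟩ := Set.nonempty_of_ncard_ne_zero hV
  have := le_ncard_oddChar_vanishing hp2 hcard h χ hχ h0
  omega

end Group

/-! ## §2 Abelian CM fields of degree `2p^k`: no rank strictly between `p^k + 2 − p` and `p^k + 1` -/

section Field

variable {K : Type} [Field K] [NumberField K] [IsCMField K] [Normal ℚ K] [IsMulCommutative (K ≃ₐ[ℚ] K)]
variable {p : ℕ} [hp : Fact p.Prime] {k : ℕ} {ρ : K ≃ₐ[ℚ] K} {φ₀ : K →+* ℂ}

omit [IsCMField K] in
/-- **THE RANK GAP for an abelian CM field of degree `2p^k`** (`p` odd): a DEGENERATE CM type has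
`Rank ≤ p^k + 2 − p`. [cite: Kubota1965, §4 Lemma 2] [cite: Dodson1987, Thm. 1.12 and Remark 4.7] -/
theorem cmTypeRank_add_le_of_not_isNondegenerate (hp2 : p ≠ 2) (hρ : ∀ x, φ₀ (ρ x) = starRingEnd ℂ (φ₀ x))
    (hK : Module.finrank ℚ K = 2 * p ^ k) (Φ : CMType K) (hdeg : ¬ IsNondegenerate Φ) :
    cmTypeRank Φ + (p - 1) ≤ p ^ k + 1 := by
  have hcardG : Fintype.card (K ≃ₐ[ℚ] K) = 2 * p ^ k := by rw [card_gal_eq_finrank φ₀, hK]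
  rw [_root_.Literature.AlgebraicGeometry.Pohlmann1968.isNondegenerate_iff,
    CyclicPrimePower.finrank_div_two_eq hK] at hdeg
  rw [cmTypeRank_eq_typeRank_galType Φ φ₀] at hdeg ⊢
  exact typeRank_add_le_of_ne hp2 hcardG (isCMTypeWith_galType hρ Φ) hdeg

omit hp in
/-- **Coordinate-free: every CM type of an abelian CM field of degree `2p^k` has rank `p^k + 1` or
`≤ p^k + 2 − p`.** [cite: Kubota1965, §4 Lemma 2] [cite: Dodson1987, Thm. 1.12 and Remark 4.7] -/
theorem cmTypeRank_eq_or_le (hprime : p.Prime) (hp2 : p ≠ 2) (hK : Module.finrank ℚ K = 2 * p ^ k)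
    (Φ : CMType K) : cmTypeRank Φ = p ^ k + 1 ∨ cmTypeRank Φ + (p - 1) ≤ p ^ k + 1 := by
  haveI : Fact p.Prime := ⟨hprime⟩
  obtain ⟨φ₀⟩ := (inferInstance : Nonempty (K →+* ℂ))
  obtain ⟨ρ, hρall⟩ := exists_conj_gal (K := K)
  by_cases hnd : IsNondegenerate Φ
  · left
    rwa [_root_.Literature.AlgebraicGeometry.Pohlmann1968.isNondegenerate_iff,
      CyclicPrimePower.finrank_div_two_eq hK] at hnd
  · exact Or.inr (cmTypeRank_add_le_of_not_isNondegenerate hp2 (hρall φ₀) hK Φ hnd)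

omit hp in
/-- **Degree `54`, any abelian CM field (`ℚ(ζ₈₁)`, or group `⟨ρ⟩ × ℤ₉ × ℤ₃`, `⟨ρ⟩ × (ℤ/3)³`): every CM type has rank
`28` or `≤ 26` — `27` is not a rank.** [cite: Dodson1987, Remark 4.7] [cite: Kubota1965, §4 Lemma 2] -/
theorem cmTypeRank_eq_or_le_fiftyFour (hK : Module.finrank ℚ K = 54) (Φ : CMType K) :
    cmTypeRank Φ = 28 ∨ cmTypeRank Φ ≤ 26 := by
  have hK' : Module.finrank ℚ K = 2 * 3 ^ 3 := by rw [hK]; norm_num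
  rcases cmTypeRank_eq_or_le Nat.prime_three (by norm_num) hK' Φ with h | h
  · left; norm_num at h; exact h
  · right; norm_num at h; omega

omit hp in
/-- **Degree `250 = 2·5³`, any abelian CM field (e.g. `ℚ(ζ₂₅₁)`): every CM type has rank `126` or `≤ 122`.**
[cite: Dodson1987, Remark 4.7] [cite: Kubota1965, §4 Lemma 2] -/
theorem cmTypeRank_eq_or_le_twoHundredFifty (hK : Module.finrank ℚ K = 250) (Φ : CMType K) :
    cmTypeRank Φ = 126 ∨ cmTypeRank Φ ≤ 122 := by
  have hK' : Module.finrank ℚ K = 2 * 5 ^ 3 := by rw [hK]; norm_num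
  rcases cmTypeRank_eq_or_le (by norm_num : Nat.Prime 5) (by norm_num) hK' Φ with h | h
  · left; norm_num at h; exact h
  · right; norm_num at h; omega

end Field

end AbelianPrimePower

end Literature.AlgebraicGeometry.Pohlmann1968
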